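import Mathlib.Data.Real.Basic
import Mathlib.Algebra.Order.Field.Basic
import Mathlib.Tactic.Linarith
import Mathlib.Tactic.Positivity
import Mathlib.Tactic.Ring
import Mathlib.Tactic.FieldSimp
import HarnessLib

/-!
# `NoHeavyLowerTail` (stmt-CriticalPhenomena-4575) — the ALL-EDGE AM–GM step in WINDOW form and the AMPLIFICATION identity

Support file (prover prim-ineq-gen-8 gen 49; `--supports stmt-CriticalPhenomena-4575`; memo
run/shared/lean/prim/prim-ineq-gen-8/FINDING-gen49-ALLEDGE.md).  Pure real algebra: no definitions, no named facts, no sorries.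

SETTING (memo §1; gen 48 file `…APLVwAMGMStep.lean`).  For ANY edge `e` (weight `p`, `q = 1 − p`) of a finite weighted graph with apex
and loads — boundary edge or not — conditioning on `e` gives the exact recursions `V = pV¹ + qV⁰ + pq a²`, `F = pF¹ + qF⁰ + pq c`,
`EL = pE¹ + qE⁰`, `|C| = p|C¹| + q|C⁰| + pq a β` with `a = E¹L − E⁰L ≥ 0`, `c = Σ_z ℓ_z (p¹_z − p⁰_z)² ≥ 0` and
`β = E⁰R − E¹R` (of EITHER sign for a deep edge: merging two off-apex clusters raises `R`).  The hypothesis-only step for (V-F) at `e` is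
`V² ≤ F (p (V¹)²/F¹ + q (V⁰)²/F⁰ + 2 p q a β)` (`amgm_step` of the gen-48 file assembles it and assumes no sign of `β`).
THIS FILE [this work]:
* `vf_step_window` — the step in WINDOW form: it holds as soon as the instance's ratio `Θ = V/F` lies outside the window of `e`,
  i.e. `c V² − 2 a² V F + 2 a β F² ≥ 0` (exact slack = children's dispersion + `pq`·window quadratic; key identity
  `window_poly_identity`).  `step_of_le_sizeBiased` is the case `c = 0` (the (V)/(Q0) reading, `EL` for `F`): the step holds whenever
  `a·V ≤ β·EL`, "variance/mean ratio at most the size-biased increment `β/a` of the edge".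
* `amplified_margin` — the AMPLIFICATION identity: gluing `N` independent copies of an instance at the apex multiplies `V, EL` by `N`,
  leaves every edge datum `(a, β)` unchanged, and the (V)-step margin at an edge of copy 1 is `N·2pq a(βE − aV) + p²q²a⁴ + pq Δ_N`
  with `Δ_N` bounded (`amplified_margin_le`).  Hence if `a V > β E` at EVERY edge of some instance, then for `N` large NO edge of the
  glued instance satisfies the (V)-step: the all-edge hypothesis-only induction for (V) is equivalent to the one-level inequality
  `V/EL ≤ max_e β_e/a_e`, which is false (memo §3, exact 7-vertex instance); the (V-F) and (Q0) analogues survive every test (memo §4).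
-/

noncomputable section

namespace Summit.CriticalPhenomena.PercolationContinuityZ3.Theorems

namespace APL

/-! ### The all-edge step in window form -/

/-- **Key polynomial identity.**  With `V = V̄ + pq a²`, `F = F̄ + pq c`:
`F² V̄² + pq F̄ (2a² V F − c V²) − F F̄ V² = p²q² (c V̄ − a² F̄)²`. [this work] -/
theorem window_poly_identity (p a c Vb Fb V F : ℝ) (hV : V = Vb + p * (1 - p) * a ^ 2) (hF : F = Fb + p * (1 - p) * c) :
    F ^ 2 * Vb ^ 2 + p * (1 - p) * Fb * (2 * a ^ 2 * V * F - c * V ^ 2) - F * Fb * V ^ 2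
      = (p * (1 - p)) ^ 2 * (c * Vb - a ^ 2 * Fb) ^ 2 := by
  rw [hV, hF]; ring

/-- **Two-point Cauchy–Schwarz (Sedrakyan), division form.**  For `F¹, F⁰ > 0` and `p ∈ [0,1]`:
`(pV¹ + qV⁰)² ≤ (pF¹ + qF⁰)(p(V¹)²/F¹ + q(V⁰)²/F⁰)`. [standard; this work records it] -/
theorem sedrakyan_two (p V1 V0 F1 F0 : ℝ) (hp0 : 0 ≤ p) (hp1 : p ≤ 1) (hF1 : 0 < F1) (hF0 : 0 < F0) :
    (p * V1 + (1 - p) * V0) ^ 2 ≤ (p * F1 + (1 - p) * F0) * (p * (V1 ^ 2 / F1) + (1 - p) * (V0 ^ 2 / F0)) := by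
  have hq : 0 ≤ 1 - p := by linarith
  have hpos : 0 < F1 * F0 := mul_pos hF1 hF0
  have hfrac : F1 * F0 * ((p * F1 + (1 - p) * F0) * (p * (V1 ^ 2 / F1) + (1 - p) * (V0 ^ 2 / F0)))
      = (p * F1 + (1 - p) * F0) * (p * F0 * V1 ^ 2 + (1 - p) * F1 * V0 ^ 2) := by
    field_simp
  have hcs : (p * F1 + (1 - p) * F0) * (p * F0 * V1 ^ 2 + (1 - p) * F1 * V0 ^ 2)
      = F1 * F0 * (p * V1 + (1 - p) * V0) ^ 2 + p * (1 - p) * (V1 * F0 - V0 * F1) ^ 2 := by ring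
  have hsq : 0 ≤ p * (1 - p) * (V1 * F0 - V0 * F1) ^ 2 := mul_nonneg (mul_nonneg hp0 hq) (sq_nonneg _)
  have key : F1 * F0 * (p * V1 + (1 - p) * V0) ^ 2
      ≤ F1 * F0 * ((p * F1 + (1 - p) * F0) * (p * (V1 ^ 2 / F1) + (1 - p) * (V0 ^ 2 / F0))) := by
    rw [hfrac, hcs]; linarith
  exact le_of_mul_le_mul_left key hpos

/-- **All-edge (V-F) step in window form.**  `0 ≤ p ≤ 1`, `F¹, F⁰ > 0`, `c ≥ 0`, recursions `V = pV¹ + qV⁰ + pq a²`,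
`F = pF¹ + qF⁰ + pq c`.  If `Θ = V/F` lies OUTSIDE the window of the edge, i.e. `c V² − 2a² V F + 2aβ F² ≥ 0`, then the
hypothesis-only step `V² ≤ F (p(V¹)²/F¹ + q(V⁰)²/F⁰ + 2pq a β)` holds (for `β` of any sign).  With `EL` in place of `F` and `c = 0`
this is the (V)-step (resp. the (Q0)-step with `b⁺` for `β`). [this work] -/
theorem vf_step_window (p a c beta V1 V0 F1 F0 V F : ℝ) (hp0 : 0 ≤ p) (hp1 : p ≤ 1) (hF1 : 0 < F1) (hF0 : 0 < F0)
    (hc : 0 ≤ c) (hV : V = p * V1 + (1 - p) * V0 + p * (1 - p) * a ^ 2)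
    (hF : F = p * F1 + (1 - p) * F0 + p * (1 - p) * c)
    (hwin : 0 ≤ c * V ^ 2 - 2 * a ^ 2 * V * F + 2 * a * beta * F ^ 2) :
    V ^ 2 ≤ F * (p * (V1 ^ 2 / F1) + (1 - p) * (V0 ^ 2 / F0) + 2 * (p * (1 - p)) * a * beta) := by
  have hq : 0 ≤ 1 - p := by linarith
  have hpq : 0 ≤ p * (1 - p) := mul_nonneg hp0 hq
  obtain ⟨Fb, hFb⟩ : ∃ Fb : ℝ, Fb = p * F1 + (1 - p) * F0 := ⟨_, rfl⟩
  obtain ⟨Vb, hVb⟩ : ∃ Vb : ℝ, Vb = p * V1 + (1 - p) * V0 := ⟨_, rfl⟩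
  obtain ⟨S, hS⟩ : ∃ S : ℝ, S = p * (V1 ^ 2 / F1) + (1 - p) * (V0 ^ 2 / F0) := ⟨_, rfl⟩
  have hFbpos : 0 < Fb := by
    rw [hFb]
    rcases lt_or_eq_of_le hp1 with hlt | heq
    · have h1 : 0 < (1 - p) * F0 := mul_pos (by linarith) hF0
      have h2 : 0 ≤ p * F1 := mul_nonneg hp0 hF1.le
      linarith
    · rw [heq]; linarith
  have hpqc : 0 ≤ p * (1 - p) * c := mul_nonneg hpq hc
  have hFpos : 0 < F := by rw [hF]; linarith
  -- (A) Sedrakyan: Vb² ≤ Fb * S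
  have hA : Vb ^ 2 ≤ Fb * S := by rw [hVb, hFb, hS]; exact sedrakyan_two p V1 V0 F1 F0 hp0 hp1 hF1 hF0
  -- (B) multiply by F ≥ 0:  F² Vb² ≤ F Fb (F S)
  have hB : F ^ 2 * Vb ^ 2 ≤ F * Fb * (F * S) := by
    have := mul_le_mul_of_nonneg_left hA (mul_nonneg hFpos.le hFpos.le)
    have e1 : F * F * (Vb ^ 2) = F ^ 2 * Vb ^ 2 := by ring
    have e2 : F * F * (Fb * S) = F * Fb * (F * S) := by ring
    linarith [e1, e2]
  -- (C) the window hypothesis, multiplied by pq Fb ≥ 0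
  have hC : p * (1 - p) * Fb * (2 * a ^ 2 * V * F - c * V ^ 2) ≤ p * (1 - p) * Fb * (2 * a * beta * F ^ 2) := by
    exact mul_le_mul_of_nonneg_left (by linarith) (mul_nonneg hpq hFbpos.le)
  -- the polynomial identity and the nonnegative square
  have hid := window_poly_identity p a c Vb Fb V F (by rw [hV, hVb]) (by rw [hF, hFb])
  have hsq : 0 ≤ (p * (1 - p)) ^ 2 * (c * Vb - a ^ 2 * Fb) ^ 2 := by positivity
  -- assemble: F Fb V² ≤ F Fb (F (S + 2 pq a β))
  have key : F * Fb * V ^ 2 ≤ F * Fb * (F * (S + 2 * (p * (1 - p)) * a * beta)) := by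
    have e3 : F * Fb * (F * (S + 2 * (p * (1 - p)) * a * beta))
        = F * Fb * (F * S) + p * (1 - p) * Fb * (2 * a * beta * F ^ 2) := by ring
    linarith [hid, hsq, hB, hC, e3]
  have hFFb : 0 < F * Fb := mul_pos hFpos hFbpos
  have hfin := le_of_mul_le_mul_left key hFFb
  rw [hS] at hfin
  exact hfin

/-- **Below the window ⟹ step** (the (V)/(Q0) reading, `c = 0`).  `0 ≤ p ≤ 1`, `E¹, E⁰ > 0`, `a ≥ 0`,
`V = pV¹ + qV⁰ + pq a²`, `EL = pE¹ + qE⁰`.  If `a · V ≤ β · EL` (the variance/mean ratio is at most the size-biased increment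
`β/a` of the edge), then `V² ≤ EL (p(V¹)²/E¹ + q(V⁰)²/E⁰ + 2pq a β)`.  For (Q0) read `β` as `b⁺`. [this work] -/
theorem step_of_le_sizeBiased (p a beta V1 V0 E1 E0 V EL : ℝ) (hp0 : 0 ≤ p) (hp1 : p ≤ 1) (hE1 : 0 < E1) (hE0 : 0 < E0)
    (ha : 0 ≤ a) (hV : V = p * V1 + (1 - p) * V0 + p * (1 - p) * a ^ 2) (hEL : EL = p * E1 + (1 - p) * E0)
    (hle : a * V ≤ beta * EL) :
    V ^ 2 ≤ EL * (p * (V1 ^ 2 / E1) + (1 - p) * (V0 ^ 2 / E0) + 2 * (p * (1 - p)) * a * beta) := by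
  have hq : 0 ≤ 1 - p := by linarith
  have hELnn : 0 ≤ EL := by
    rw [hEL]; have := mul_nonneg hp0 hE1.le; have := mul_nonneg hq hE0.le; linarith
  have hwin : 0 ≤ 0 * V ^ 2 - 2 * a ^ 2 * V * EL + 2 * a * beta * EL ^ 2 := by
    have h1 : 0 ≤ a * EL * (beta * EL - a * V) := mul_nonneg (mul_nonneg ha hELnn) (by linarith)
    have e : 0 * V ^ 2 - 2 * a ^ 2 * V * EL + 2 * a * beta * EL ^ 2 = 2 * (a * EL * (beta * EL - a * V)) := by ring
    rw [e]; linarith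
  exact vf_step_window p a 0 beta V1 V0 E1 E0 V EL hp0 hp1 hE1 hE0 le_rfl hV (by rw [hEL]; ring) hwin

/-! ### Amplification: `N` independent copies glued at the apex -/

/-- **Amplified margin identity.**  Glue `N` independent copies of an instance (`V`, `E = EL`) at the apex and condition on an edge of
copy 1 (children `V¹,E¹` / `V⁰,E⁰` of that copy, `V = pV¹ + qV⁰ + pq a²`, `E = pE¹ + qE⁰`): the glued instance has variance `N V`,
mean `N E`, children `Vⁱ + (N−1)V`, `Eⁱ + (N−1)E`, and the same edge data `a, β`.  Its (V)-step margin
`M_N = N E (p(V¹_N)²/E¹_N + q(V⁰_N)²/E⁰_N + 2pq aβ) − (N V)²` satisfies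
`E¹_N E⁰_N · M_N = E¹_N E⁰_N · (N · 2pq a (β E − a V) + p²q² a⁴) + pq (V¹_N E⁰_N − V⁰_N E¹_N)²`. [this work] -/
theorem amplified_margin (p a beta V1 V0 E1 E0 V E N : ℝ)
    (hV : V = p * V1 + (1 - p) * V0 + p * (1 - p) * a ^ 2) (hE : E = p * E1 + (1 - p) * E0)
    (hE1N : E1 + (N - 1) * E ≠ 0) (hE0N : E0 + (N - 1) * E ≠ 0) :
    (E1 + (N - 1) * E) * (E0 + (N - 1) * E) *
        (N * E * (p * ((V1 + (N - 1) * V) ^ 2 / (E1 + (N - 1) * E))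
                  + (1 - p) * ((V0 + (N - 1) * V) ^ 2 / (E0 + (N - 1) * E)) + 2 * (p * (1 - p)) * a * beta)
          - (N * V) ^ 2)
      = (E1 + (N - 1) * E) * (E0 + (N - 1) * E) * (N * (2 * (p * (1 - p)) * a * (beta * E - a * V)) + (p * (1 - p)) ^ 2 * a ^ 4)
        + p * (1 - p) * ((V1 + (N - 1) * V) * (E0 + (N - 1) * E) - (V0 + (N - 1) * V) * (E1 + (N - 1) * E)) ^ 2 := by
  -- clear the two denominators by hand
  have h1 : (E1 + (N - 1) * E) * (p * ((V1 + (N - 1) * V) ^ 2 / (E1 + (N - 1) * E))) = p * (V1 + (N - 1) * V) ^ 2 := by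
    field_simp
  have h0 : (E0 + (N - 1) * E) * ((1 - p) * ((V0 + (N - 1) * V) ^ 2 / (E0 + (N - 1) * E))) = (1 - p) * (V0 + (N - 1) * V) ^ 2 := by
    field_simp
  have expand : (E1 + (N - 1) * E) * (E0 + (N - 1) * E) *
        (N * E * (p * ((V1 + (N - 1) * V) ^ 2 / (E1 + (N - 1) * E))
                  + (1 - p) * ((V0 + (N - 1) * V) ^ 2 / (E0 + (N - 1) * E)) + 2 * (p * (1 - p)) * a * beta)
          - (N * V) ^ 2)
      = N * E * ((E0 + (N - 1) * E) * ((E1 + (N - 1) * E) * (p * ((V1 + (N - 1) * V) ^ 2 / (E1 + (N - 1) * E))))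
                + (E1 + (N - 1) * E) * ((E0 + (N - 1) * E) * ((1 - p) * ((V0 + (N - 1) * V) ^ 2 / (E0 + (N - 1) * E))))
                + (E1 + (N - 1) * E) * (E0 + (N - 1) * E) * (2 * (p * (1 - p)) * a * beta))
        - (E1 + (N - 1) * E) * (E0 + (N - 1) * E) * (N * V) ^ 2 := by ring
  rw [expand, h1, h0, hV, hE]
  ring

/-- **Cross term of the glued instance** (linear in `N`): with `δ₀ = V¹E⁰ − V⁰E¹`, `δ₁ = (V¹ − V⁰)E − V(E¹ − E⁰)`,
`V¹_N E⁰_N − V⁰_N E¹_N = δ₀ + (N−1)δ₁`. [this work] -/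
theorem amplified_cross (V1 V0 E1 E0 V E N : ℝ) :
    (V1 + (N - 1) * V) * (E0 + (N - 1) * E) - (V0 + (N - 1) * V) * (E1 + (N - 1) * E)
      = (V1 * E0 - V0 * E1) + (N - 1) * ((V1 - V0) * E - V * (E1 - E0)) := by
  ring

/-- **Amplification bound.**  `p ∈ [0,1]`, `E¹, E⁰, E > 0`, `N ≥ 2`, recursions as in `amplified_margin`.  Then the (V)-step margin
of the `N`-fold glued instance at the chosen edge obeys
`M_N ≤ N · 2pq a(βE − aV) + p²q²a⁴ + pq · 2(δ₀² + δ₁²)/E²`.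
Consequently, if `a V > β E` (the instance's ratio `V/E` exceeds the size-biased increment `β/a` of this edge), `M_N < 0` for all
large `N`: the all-edge hypothesis-only (V)-step cannot hold at every instance unless the one-level inequality `V/E ≤ max_e β_e/a_e`
does (memo §3: it does not). [this work] -/
theorem amplified_margin_le (p a beta V1 V0 E1 E0 V E N : ℝ) (hp0 : 0 ≤ p) (hp1 : p ≤ 1)
    (hE1 : 0 < E1) (hE0 : 0 < E0) (hEpos : 0 < E) (hN : 2 ≤ N)
    (hV : V = p * V1 + (1 - p) * V0 + p * (1 - p) * a ^ 2) (hE : E = p * E1 + (1 - p) * E0) :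
    N * E * (p * ((V1 + (N - 1) * V) ^ 2 / (E1 + (N - 1) * E))
              + (1 - p) * ((V0 + (N - 1) * V) ^ 2 / (E0 + (N - 1) * E)) + 2 * (p * (1 - p)) * a * beta)
        - (N * V) ^ 2
      ≤ N * (2 * (p * (1 - p)) * a * (beta * E - a * V)) + (p * (1 - p)) ^ 2 * a ^ 4
        + p * (1 - p) * (2 * ((V1 * E0 - V0 * E1) ^ 2 + ((V1 - V0) * E - V * (E1 - E0)) ^ 2) / E ^ 2) := by
  have hq : 0 ≤ 1 - p := by linarith
  have hpq : 0 ≤ p * (1 - p) := mul_nonneg hp0 hq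
  have hN1 : 1 ≤ N - 1 := by linarith
  obtain ⟨A, hA⟩ : ∃ A : ℝ, A = E1 + (N - 1) * E := ⟨_, rfl⟩
  obtain ⟨B, hB⟩ : ∃ B : ℝ, B = E0 + (N - 1) * E := ⟨_, rfl⟩
  obtain ⟨d0, hd0⟩ : ∃ d0 : ℝ, d0 = V1 * E0 - V0 * E1 := ⟨_, rfl⟩
  obtain ⟨d1, hd1⟩ : ∃ d1 : ℝ, d1 = (V1 - V0) * E - V * (E1 - E0) := ⟨_, rfl⟩
  have hNE : E ≤ (N - 1) * E := by nlinarith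
  have hAge : E ≤ A := by rw [hA]; linarith
  have hBge : E ≤ B := by rw [hB]; linarith
  have hAge' : (N - 1) * E ≤ A := by rw [hA]; linarith
  have hBge' : (N - 1) * E ≤ B := by rw [hB]; linarith
  have hApos : 0 < A := lt_of_lt_of_le hEpos hAge
  have hBpos : 0 < B := lt_of_lt_of_le hEpos hBge
  have hAB : 0 < A * B := mul_pos hApos hBpos
  have hE2 : 0 < E ^ 2 := by positivity
  -- E² ≤ A B and ((N-1)E)² ≤ A B
  have hE2AB : E ^ 2 ≤ A * B := by nlinarith [mul_le_mul hAge hBge hEpos.le hApos.le]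
  have hNE2AB : ((N - 1) * E) ^ 2 ≤ A * B := by
    have hNEpos : 0 ≤ (N - 1) * E := by nlinarith
    nlinarith [mul_le_mul hAge' hBge' hNEpos hApos.le]
  -- the identity, divided by A B
  have hid := amplified_margin p a beta V1 V0 E1 E0 V E N hV hE (by rw [← hA]; exact ne_of_gt hApos)
    (by rw [← hB]; exact ne_of_gt hBpos)
  rw [amplified_cross] at hid
  rw [← hA, ← hB, ← hd0, ← hd1] at hid
  -- bound the cross term: (d0 + (N-1) d1)² E² ≤ 2 (d0² + d1²) A B
  have hcr : (d0 + (N - 1) * d1) ^ 2 ≤ 2 * d0 ^ 2 + 2 * ((N - 1) * d1) ^ 2 := by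
    nlinarith [sq_nonneg (d0 - (N - 1) * d1)]
  have hb1 : d0 ^ 2 * E ^ 2 ≤ d0 ^ 2 * (A * B) := mul_le_mul_of_nonneg_left hE2AB (sq_nonneg d0)
  have hb2 : ((N - 1) * d1) ^ 2 * E ^ 2 ≤ d1 ^ 2 * (A * B) := by
    have e : ((N - 1) * d1) ^ 2 * E ^ 2 = d1 ^ 2 * ((N - 1) * E) ^ 2 := by ring
    rw [e]; exact mul_le_mul_of_nonneg_left hNE2AB (sq_nonneg d1)
  have hbound : (d0 + (N - 1) * d1) ^ 2 * E ^ 2 ≤ 2 * (d0 ^ 2 + d1 ^ 2) * (A * B) := by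
    have h := mul_le_mul_of_nonneg_right hcr hE2.le
    have e : (2 * d0 ^ 2 + 2 * ((N - 1) * d1) ^ 2) * E ^ 2 = 2 * (d0 ^ 2 * E ^ 2) + 2 * (((N - 1) * d1) ^ 2 * E ^ 2) := by ring
    linarith [h, hb1, hb2, e]
  have hdiv : p * (1 - p) * (d0 + (N - 1) * d1) ^ 2
      ≤ A * B * (p * (1 - p) * (2 * (d0 ^ 2 + d1 ^ 2) / E ^ 2)) := by
    have h2 : (d0 + (N - 1) * d1) ^ 2 ≤ 2 * (d0 ^ 2 + d1 ^ 2) * (A * B) / E ^ 2 := by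
      rw [le_div_iff₀ hE2]; exact hbound
    have h3 := mul_le_mul_of_nonneg_left h2 hpq
    have e : A * B * (p * (1 - p) * (2 * (d0 ^ 2 + d1 ^ 2) / E ^ 2))
        = p * (1 - p) * (2 * (d0 ^ 2 + d1 ^ 2) * (A * B) / E ^ 2) := by ring
    rw [e]; exact h3
  have hfin : A * B * (N * E * (p * ((V1 + (N - 1) * V) ^ 2 / A) + (1 - p) * ((V0 + (N - 1) * V) ^ 2 / B)
                + 2 * (p * (1 - p)) * a * beta) - (N * V) ^ 2)
      ≤ A * B * (N * (2 * (p * (1 - p)) * a * (beta * E - a * V)) + (p * (1 - p)) ^ 2 * a ^ 4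
        + p * (1 - p) * (2 * (d0 ^ 2 + d1 ^ 2) / E ^ 2)) := by
    rw [hid]
    have e : A * B * (N * (2 * (p * (1 - p)) * a * (beta * E - a * V)) + (p * (1 - p)) ^ 2 * a ^ 4
          + p * (1 - p) * (2 * (d0 ^ 2 + d1 ^ 2) / E ^ 2))
        = A * B * (N * (2 * (p * (1 - p)) * a * (beta * E - a * V)) + (p * (1 - p)) ^ 2 * a ^ 4)
          + A * B * (p * (1 - p) * (2 * (d0 ^ 2 + d1 ^ 2) / E ^ 2)) := by ring
    rw [e]; linarith [hdiv]
  have hres := le_of_mul_le_mul_left hfin hAB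
  rw [hA, hB, hd0, hd1] at hres
  exact hres

/-- **Amplified margin identity, (V-F) version.**  As `amplified_margin`, for the (V-F) step with `F = pF¹ + qF⁰ + pq c`: gluing `N` copies
at the apex (`F_N = N F`, children `Fⁱ_N = Fⁱ + (N−1)F`, `Vⁱ_N = Vⁱ + (N−1)V`), the (V-F)-step margin
`M_N = N F (p(V¹_N)²/F¹_N + q(V⁰_N)²/F⁰_N + 2pq aβ) − (N V)²` satisfies
`F¹_N F⁰_N · M_N = F¹_N F⁰_N (N · 2pq a(βF − aV) + p²q²a⁴) + pq (V¹_N F⁰_N − V⁰_N F¹_N)² + pq c (p F⁰_N (V¹_N)² + q F¹_N (V⁰_N)²)`;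
divided by `F¹_N F⁰_N` the last term is `pq c (p(V¹_N)²/F¹_N + q(V⁰_N)²/F⁰_N) ≈ N pq c V²/F`, so the leading coefficient in `N` is
`pq F · (c Θ² − 2a²Θ + 2aβ)`, `Θ = V/F`: the window quadratic of `vf_step_window` (memo §4(a), §5). [this work] -/
theorem amplified_margin_F (p a c beta V1 V0 F1 F0 V F N : ℝ)
    (hV : V = p * V1 + (1 - p) * V0 + p * (1 - p) * a ^ 2) (hF : F = p * F1 + (1 - p) * F0 + p * (1 - p) * c)
    (hF1N : F1 + (N - 1) * F ≠ 0) (hF0N : F0 + (N - 1) * F ≠ 0) :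
    (F1 + (N - 1) * F) * (F0 + (N - 1) * F) *
        (N * F * (p * ((V1 + (N - 1) * V) ^ 2 / (F1 + (N - 1) * F))
                  + (1 - p) * ((V0 + (N - 1) * V) ^ 2 / (F0 + (N - 1) * F)) + 2 * (p * (1 - p)) * a * beta)
          - (N * V) ^ 2)
      = (F1 + (N - 1) * F) * (F0 + (N - 1) * F) * (N * (2 * (p * (1 - p)) * a * (beta * F - a * V)) + (p * (1 - p)) ^ 2 * a ^ 4)
        + p * (1 - p) * ((V1 + (N - 1) * V) * (F0 + (N - 1) * F) - (V0 + (N - 1) * V) * (F1 + (N - 1) * F)) ^ 2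
        + p * (1 - p) * c * (p * (F0 + (N - 1) * F) * (V1 + (N - 1) * V) ^ 2
                             + (1 - p) * (F1 + (N - 1) * F) * (V0 + (N - 1) * V) ^ 2) := by
  have h1 : (F1 + (N - 1) * F) * (p * ((V1 + (N - 1) * V) ^ 2 / (F1 + (N - 1) * F))) = p * (V1 + (N - 1) * V) ^ 2 := by
    field_simp
  have h0 : (F0 + (N - 1) * F) * ((1 - p) * ((V0 + (N - 1) * V) ^ 2 / (F0 + (N - 1) * F))) = (1 - p) * (V0 + (N - 1) * V) ^ 2 := by
    field_simp
  have expand : (F1 + (N - 1) * F) * (F0 + (N - 1) * F) *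
        (N * F * (p * ((V1 + (N - 1) * V) ^ 2 / (F1 + (N - 1) * F))
                  + (1 - p) * ((V0 + (N - 1) * V) ^ 2 / (F0 + (N - 1) * F)) + 2 * (p * (1 - p)) * a * beta)
          - (N * V) ^ 2)
      = N * F * ((F0 + (N - 1) * F) * ((F1 + (N - 1) * F) * (p * ((V1 + (N - 1) * V) ^ 2 / (F1 + (N - 1) * F))))
                + (F1 + (N - 1) * F) * ((F0 + (N - 1) * F) * ((1 - p) * ((V0 + (N - 1) * V) ^ 2 / (F0 + (N - 1) * F))))
                + (F1 + (N - 1) * F) * (F0 + (N - 1) * F) * (2 * (p * (1 - p)) * a * beta))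
        - (F1 + (N - 1) * F) * (F0 + (N - 1) * F) * (N * V) ^ 2 := by ring
  rw [expand, h1, h0, hV, hF]
  ring

end APL

end Summit.CriticalPhenomena.PercolationContinuityZ3.Theorems
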